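import Summits.Ventures.GridStability.Models.LurieChannelBounds
import HarnessLib

/-!
# GridStability/Lyapunov/WSCC9LurieObstructionTests — the Lemma-1 LMI of a circle-criterion certificate read at
# five test vectors of the lossy 9-bus Lur'e object «WSCC9-postB-SPdamp-h12», and enclosures of its directed weights

Cell `gridfusion` (LADDER-GRIDFUSION), LOSSY TIER; seat gridfusion-lyap-1 (g4); namespace
`Summit.Ventures.GridStability.Lyapunov.LurieObstruction`. Technical first half of the CERTIFIED NEGATIVE
`Lyapunov/WSCC9LurieObstruction.lean` (see that file for the statement, the proof outline and the three columns).

CONTENTS. `lmi_quadForm` — the matrix inequality of lit-6's `QuadraticCertificate` [cite: VuTuritsyn2017, §4.2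
Lemma 1] read at ONE state vector: `0 ≤ −2⟨Av,Pv⟩ + g‖Cv‖² − ‖Bᵀ(Pv) − ((1+g)/2)Cv‖²` (any `System`).
For the instance `WSCC9.lurieSystem` (model-1 p493501; states `(ω₀, ω₁, ω₂ | σ₁, σ₂)`, nine directed channels,
`A = [[−diag λ, 0],[T, 0]]`, `B = [directedInput; 0]`, `C = [0 | pairIncidence]` — `lurieSystem_A/B/C`,
definitional): the five evaluations `test_ω1`, `test_ω2`, `test_ω0` (speed directions, `Cx = 0`) and `test_σ1`,
`test_σ2` (angle directions, `Ax = 0`) as explicit polynomial inequalities in the entries of `P`, the gain `g` and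
the irrational polar moduli `Y_pq = √(B_pq² + G_pq²)`; `P_symm_apply`; `Ypol_bounds` + the six enclosures
`Y.._bounds` (7 significant digits, from `lo² ≤ Ysq ≤ hi²` decided over `ℚ`, model-1's `Ypol_sq_cast` p494922).
THREE COLUMNS. CERTIFIED: kernel identities/inequalities about the typed object. MODELLED: «WSCC9-postB-SPdamp-h12»
(MV-2 WITH transfer conductances + MV-P + MV-SPD + MV-ω + MV-h12). VALIDATED: nothing. No sentence here says
that any grid is stable. No definition, no named fact, standard axioms.
-/

noncomputable section

open Real Set Finset Matrix
open Literature.MathematicalPhysics.PowerSystems (InternalNode)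
open Literature.MathematicalPhysics.PowerSystems.LyapunovFunctionFamily

namespace Summit.Ventures.GridStability.Lyapunov.LurieObstruction

/-! ### The quadratic form of Lemma 1's matrix inequality at a test vector -/

section General

variable {ι κ : Type*} [Fintype ι] [Fintype κ] [DecidableEq ι]

/-- **The LMI of a circle-criterion certificate read at ONE state vector** `v`: with `u = Pv`,
`R v = Bᵀu − ((1+g)/2)·Cv`,
`0 ≤ −2⟨Av, Pv⟩ + g‖Cv‖² − ‖Bᵀ(Pv) − ((1+g)/2)Cv‖²` (the quadratic form of `−(AᵀP + PA − gCᵀC + RᵀR)`).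
[cite: VuTuritsyn2017, §4.2 Lemma 1] -/
theorem lmi_quadForm {S : System ι κ} (Λ : QuadraticCertificate S) (v : ι → ℝ) :
    0 ≤ -(2 * ((S.A *ᵥ v) ⬝ᵥ (Λ.P *ᵥ v))) + Λ.g * ((S.C *ᵥ v) ⬝ᵥ (S.C *ᵥ v))
      - ((S.Bᵀ *ᵥ (Λ.P *ᵥ v) - ((1 + Λ.g) / 2) • (S.C *ᵥ v))
          ⬝ᵥ (S.Bᵀ *ᵥ (Λ.P *ᵥ v) - ((1 + Λ.g) / 2) • (S.C *ᵥ v))) := by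
  have h := Λ.lmi.dotProduct_mulVec_nonneg v
  rw [star_trivial] at h
  set R : Matrix κ ι ℝ := S.Bᵀ * Λ.P - ((1 + Λ.g) / 2) • S.C with hR
  have hRv : R *ᵥ v = S.Bᵀ *ᵥ (Λ.P *ᵥ v) - ((1 + Λ.g) / 2) • (S.C *ᵥ v) := by
    rw [hR, Matrix.sub_mulVec, Matrix.smul_mulVec, Matrix.mulVec_mulVec]
  -- the four pieces of `v ⬝ (M v)`
  have h1 : v ⬝ᵥ ((S.Aᵀ * Λ.P) *ᵥ v) = (S.A *ᵥ v) ⬝ᵥ (Λ.P *ᵥ v) := by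
    rw [← Matrix.mulVec_mulVec, Matrix.dotProduct_mulVec, Matrix.vecMul_transpose]
  have h2 : v ⬝ᵥ ((Λ.P * S.A) *ᵥ v) = (S.A *ᵥ v) ⬝ᵥ (Λ.P *ᵥ v) := by
    rw [← Matrix.mulVec_mulVec, Matrix.dotProduct_mulVec, ← Matrix.mulVec_transpose, Λ.P_symm,
      dotProduct_comm]
  have h3 : v ⬝ᵥ ((S.Cᵀ * S.C) *ᵥ v) = (S.C *ᵥ v) ⬝ᵥ (S.C *ᵥ v) := by
    rw [← Matrix.mulVec_mulVec, Matrix.dotProduct_mulVec, Matrix.vecMul_transpose]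
  have h4 : v ⬝ᵥ ((Rᵀ * R) *ᵥ v) = (R *ᵥ v) ⬝ᵥ (R *ᵥ v) := by
    rw [← Matrix.mulVec_mulVec, Matrix.dotProduct_mulVec, Matrix.vecMul_transpose]
  have hM : v ⬝ᵥ ((-(S.Aᵀ * Λ.P + Λ.P * S.A - Λ.g • (S.Cᵀ * S.C) + Rᵀ * R)) *ᵥ v)
      = -(2 * ((S.A *ᵥ v) ⬝ᵥ (Λ.P *ᵥ v))) + Λ.g * ((S.C *ᵥ v) ⬝ᵥ (S.C *ᵥ v))
        - (R *ᵥ v) ⬝ᵥ (R *ᵥ v) := by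
    rw [Matrix.neg_mulVec, dotProduct_neg, Matrix.add_mulVec, Matrix.sub_mulVec, Matrix.add_mulVec,
      dotProduct_add, dotProduct_sub, dotProduct_add, Matrix.smul_mulVec, dotProduct_smul, h1, h2,
      h3, h4, smul_eq_mul]
    ring
  rw [hM, hRv] at h
  exact h

end General


section Instance
open Summit.Ventures.GridStability.Models
open Literature.MathematicalPhysics.PowerSystems

/-! ### The instance's system matrices, unfolded -/

/-- `A` of the instance's Lur'e system (definitional unfolding). -/
theorem lurieSystem_A : WSCC9.lurieSystem.A =
    Matrix.fromBlocks (-Matrix.diagonal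
      (fun i => WSCC9.postB_SPdamp.toModel.toLitNode.D i / WSCC9.postB_SPdamp.toModel.toLitNode.M i))
      0 (InternalNode.refT 2) 0 := rfl

/-- `B` of the instance's Lur'e system (definitional unfolding). -/
theorem lurieSystem_B : WSCC9.lurieSystem.B =
    Matrix.fromRows (System.directedInput (fun i => 1 / WSCC9.postB_SPdamp.toModel.toLitNode.M i) Prod.fst
        (WSCC9.postB_SPdamp.toModel.toLitNode.channelWeight WSCC9.postB_SPdamp.toModel.Ypol)) 0 := rfl

/-- `C` of the instance's Lur'e system (definitional unfolding). -/
theorem lurieSystem_C : WSCC9.lurieSystem.C = Matrix.fromCols 0 (InternalNode.pairIncidence 2) := rfl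

/-- The voltages of the bookkeeping `InternalNode` are the typed rationals. -/
theorem tE (i : Fin 3) : WSCC9.postB_SPdamp.toModel.toLitNode.E i = ((WSCC9.E i : ℚ) : ℝ) := rfl

/-- The inertias are the typed rationals. -/
theorem tM (i : Fin 3) : WSCC9.postB_SPdamp.toModel.M i = ((WSCC9.M i : ℚ) : ℝ) := rfl

/-- The dampings are the typed rationals. -/
theorem tD (i : Fin 3) : WSCC9.postB_SPdamp.toModel.toLitNode.D i = ((WSCC9.D_SP i : ℚ) : ℝ) := rfl

/-! ### The five test vectors

Notation in the docstrings: `a_pq = E_pE_qY_pq/M_p` (directed channel weight over the feeding machine's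
inertia), `P = Λ.P` on the states `(ω₀, ω₁, ω₂ | σ₁, σ₂)`, `h = (1 + g)/2`. -/

/-- **Test vector `e_{ω₁}`** (only machine 1's speed): `Cx = 0`, `⟨Ax,Px⟩ = −λ₁P₁₁ + P[σ₁,ω₁]`, and the
residual is `Σ_p S_p P[ω_p,ω₁]²`; keeping machine 1's two channels:
`(a₁₀P₁₁)² + (a₁₂P₁₁)² ≤ (2/5)P₁₁ − 2P[σ₁,ω₁]`. -/
theorem test_ω1 (Λ : QuadraticCertificate WSCC9.lurieSystem) :
    ((27741033 : ℝ) / 25000000 * WSCC9.postB_SPdamp.toModel.Ypol 1 0 * (1885 / 64)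
        * Λ.P (Sum.inl 1) (Sum.inl 1)) ^ 2
      + ((5340267 : ℝ) / 5000000 * WSCC9.postB_SPdamp.toModel.Ypol 1 2 * (1885 / 64)
        * Λ.P (Sum.inl 1) (Sum.inl 1)) ^ 2
      ≤ 2 / 5 * Λ.P (Sum.inl 1) (Sum.inl 1) - 2 * Λ.P (Sum.inr 0) (Sum.inl 1) := by
  have h := lmi_quadForm Λ (Sum.elim ![0, 1, 0] ![0, 0])
  rw [lurieSystem_A, lurieSystem_B, lurieSystem_C] at h
  simp [InternalNode.refT, InternalNode.pairIncidence, System.directedInput,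
    InternalNode.channelWeight, Matrix.mulVec, dotProduct, Fintype.sum_sum_type, Fintype.sum_prod_type,
    Fin.sum_univ_three, Fin.sum_univ_two, Matrix.fromBlocks, Matrix.fromRows, Matrix.fromCols,
    Matrix.mul_apply, Matrix.diagonal, ClassicalSwing.toLitNode_M, tE, tM, tD, WSCC9.E, WSCC9.M,
    WSCC9.D_SP] at h
  norm_num at h
  nlinarith [h, mul_self_nonneg ((27741033 : ℝ) / 25000000 * WSCC9.postB_SPdamp.toModel.Ypol 0 1
      * (9425 / 1182) * Λ.P (Sum.inl 0) (Sum.inl 1)),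
    mul_self_nonneg ((5372811 : ℝ) / 5000000 * WSCC9.postB_SPdamp.toModel.Ypol 0 2
      * (9425 / 1182) * Λ.P (Sum.inl 0) (Sum.inl 1)),
    mul_self_nonneg ((5372811 : ℝ) / 5000000 * WSCC9.postB_SPdamp.toModel.Ypol 2 0
      * (18850 / 301) * Λ.P (Sum.inl 2) (Sum.inl 1)),
    mul_self_nonneg ((5340267 : ℝ) / 5000000 * WSCC9.postB_SPdamp.toModel.Ypol 2 1
      * (18850 / 301) * Λ.P (Sum.inl 2) (Sum.inl 1))]

/-- **Test vector `e_{ω₂}`**: `(a₂₀P₂₂)² + (a₂₁P₂₂)² ≤ (3/5)P₂₂ − 2P[σ₂,ω₂]`. -/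
theorem test_ω2 (Λ : QuadraticCertificate WSCC9.lurieSystem) :
    ((5372811 : ℝ) / 5000000 * WSCC9.postB_SPdamp.toModel.Ypol 2 0 * (18850 / 301)
        * Λ.P (Sum.inl 2) (Sum.inl 2)) ^ 2
      + ((5340267 : ℝ) / 5000000 * WSCC9.postB_SPdamp.toModel.Ypol 2 1 * (18850 / 301)
        * Λ.P (Sum.inl 2) (Sum.inl 2)) ^ 2
      ≤ 3 / 5 * Λ.P (Sum.inl 2) (Sum.inl 2) - 2 * Λ.P (Sum.inr 1) (Sum.inl 2) := by
  have h := lmi_quadForm Λ (Sum.elim ![0, 0, 1] ![0, 0])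
  rw [lurieSystem_A, lurieSystem_B, lurieSystem_C] at h
  simp [InternalNode.refT, InternalNode.pairIncidence, System.directedInput,
    InternalNode.channelWeight, Matrix.mulVec, dotProduct, Fintype.sum_sum_type, Fintype.sum_prod_type,
    Fin.sum_univ_three, Fin.sum_univ_two, Matrix.fromBlocks, Matrix.fromRows, Matrix.fromCols,
    Matrix.mul_apply, Matrix.diagonal, ClassicalSwing.toLitNode_M, tE, tM, tD, WSCC9.E, WSCC9.M,
    WSCC9.D_SP] at h
  norm_num at h
  nlinarith [h, mul_self_nonneg ((27741033 : ℝ) / 25000000 * WSCC9.postB_SPdamp.toModel.Ypol 0 1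
      * (9425 / 1182) * Λ.P (Sum.inl 0) (Sum.inl 2)),
    mul_self_nonneg ((5372811 : ℝ) / 5000000 * WSCC9.postB_SPdamp.toModel.Ypol 0 2
      * (9425 / 1182) * Λ.P (Sum.inl 0) (Sum.inl 2)),
    mul_self_nonneg ((27741033 : ℝ) / 25000000 * WSCC9.postB_SPdamp.toModel.Ypol 1 0
      * (1885 / 64) * Λ.P (Sum.inl 1) (Sum.inl 2)),
    mul_self_nonneg ((5340267 : ℝ) / 5000000 * WSCC9.postB_SPdamp.toModel.Ypol 1 2
      * (1885 / 64) * Λ.P (Sum.inl 1) (Sum.inl 2))]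

/-- **Test vector `e_{ω₀}`** (reference machine; `Tx = (−1, −1)`):
`(a₀₁P₀₀)² + (a₀₂P₀₀)² ≤ (1/5)P₀₀ + 2(P[σ₁,ω₀] + P[σ₂,ω₀])`. -/
theorem test_ω0 (Λ : QuadraticCertificate WSCC9.lurieSystem) :
    ((27741033 : ℝ) / 25000000 * WSCC9.postB_SPdamp.toModel.Ypol 0 1 * (9425 / 1182)
        * Λ.P (Sum.inl 0) (Sum.inl 0)) ^ 2
      + ((5372811 : ℝ) / 5000000 * WSCC9.postB_SPdamp.toModel.Ypol 0 2 * (9425 / 1182)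
        * Λ.P (Sum.inl 0) (Sum.inl 0)) ^ 2
      ≤ 1 / 5 * Λ.P (Sum.inl 0) (Sum.inl 0)
        + 2 * (Λ.P (Sum.inr 0) (Sum.inl 0) + Λ.P (Sum.inr 1) (Sum.inl 0)) := by
  have h := lmi_quadForm Λ (Sum.elim ![1, 0, 0] ![0, 0])
  rw [lurieSystem_A, lurieSystem_B, lurieSystem_C] at h
  simp [InternalNode.refT, InternalNode.pairIncidence, System.directedInput,
    InternalNode.channelWeight, Matrix.mulVec, dotProduct, Fintype.sum_sum_type, Fintype.sum_prod_type,
    Fin.sum_univ_three, Fin.sum_univ_two, Matrix.fromBlocks, Matrix.fromRows, Matrix.fromCols,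
    Matrix.mul_apply, Matrix.diagonal, ClassicalSwing.toLitNode_M, tE, tM, tD, WSCC9.E, WSCC9.M,
    WSCC9.D_SP] at h
  norm_num at h
  nlinarith [h, mul_self_nonneg ((27741033 : ℝ) / 25000000 * WSCC9.postB_SPdamp.toModel.Ypol 1 0
      * (1885 / 64) * Λ.P (Sum.inl 1) (Sum.inl 0)),
    mul_self_nonneg ((5340267 : ℝ) / 5000000 * WSCC9.postB_SPdamp.toModel.Ypol 1 2
      * (1885 / 64) * Λ.P (Sum.inl 1) (Sum.inl 0)),
    mul_self_nonneg ((5372811 : ℝ) / 5000000 * WSCC9.postB_SPdamp.toModel.Ypol 2 0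
      * (18850 / 301) * Λ.P (Sum.inl 2) (Sum.inl 0)),
    mul_self_nonneg ((5340267 : ℝ) / 5000000 * WSCC9.postB_SPdamp.toModel.Ypol 2 1
      * (18850 / 301) * Λ.P (Sum.inl 2) (Sum.inl 0))]

/-- **Test vector `e_{σ₁}`** (angle block only: `Ax = 0`, `‖Cx‖² = 4`): the six directed residuals
`(a₀₁x₀ + h)² + (a₀₂x₀)² + (a₁₀x₁ − h)² + (a₁₂x₁ − h)² + (a₂₀x₂)² + (a₂₁x₂ + h)² ≤ 4g`, `x_p = P[ω_p,σ₁]`. -/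
theorem test_σ1 (Λ : QuadraticCertificate WSCC9.lurieSystem) :
    ((27741033 : ℝ) / 25000000 * WSCC9.postB_SPdamp.toModel.Ypol 0 1 * (9425 / 1182)
          * Λ.P (Sum.inl 0) (Sum.inr 0) + (1 + Λ.g) / 2) ^ 2
      + ((5372811 : ℝ) / 5000000 * WSCC9.postB_SPdamp.toModel.Ypol 0 2 * (9425 / 1182)
          * Λ.P (Sum.inl 0) (Sum.inr 0)) ^ 2
      + ((27741033 : ℝ) / 25000000 * WSCC9.postB_SPdamp.toModel.Ypol 1 0 * (1885 / 64)
          * Λ.P (Sum.inl 1) (Sum.inr 0) - (1 + Λ.g) / 2) ^ 2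
      + ((5340267 : ℝ) / 5000000 * WSCC9.postB_SPdamp.toModel.Ypol 1 2 * (1885 / 64)
          * Λ.P (Sum.inl 1) (Sum.inr 0) - (1 + Λ.g) / 2) ^ 2
      + ((5372811 : ℝ) / 5000000 * WSCC9.postB_SPdamp.toModel.Ypol 2 0 * (18850 / 301)
          * Λ.P (Sum.inl 2) (Sum.inr 0)) ^ 2
      + ((5340267 : ℝ) / 5000000 * WSCC9.postB_SPdamp.toModel.Ypol 2 1 * (18850 / 301)
          * Λ.P (Sum.inl 2) (Sum.inr 0) + (1 + Λ.g) / 2) ^ 2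
      ≤ 4 * Λ.g := by
  have h := lmi_quadForm Λ (Sum.elim ![0, 0, 0] ![1, 0])
  rw [lurieSystem_A, lurieSystem_B, lurieSystem_C] at h
  simp [InternalNode.refT, InternalNode.pairIncidence, System.directedInput,
    InternalNode.channelWeight, Matrix.mulVec, dotProduct, Fintype.sum_sum_type, Fintype.sum_prod_type,
    Fin.sum_univ_three, Fin.sum_univ_two, Matrix.fromBlocks, Matrix.fromRows, Matrix.fromCols,
    Matrix.mul_apply, Matrix.diagonal, ClassicalSwing.toLitNode_M, tE, tM, tD, WSCC9.E, WSCC9.M,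
    WSCC9.D_SP] at h
  norm_num at h
  nlinarith [h]

/-- **Test vector `e_{σ₂}`**:
`(a₀₁y₀)² + (a₀₂y₀ + h)² + (a₁₀y₁)² + (a₁₂y₁ + h)² + (a₂₀y₂ − h)² + (a₂₁y₂ − h)² ≤ 4g`, `y_p = P[ω_p,σ₂]`. -/
theorem test_σ2 (Λ : QuadraticCertificate WSCC9.lurieSystem) :
    ((27741033 : ℝ) / 25000000 * WSCC9.postB_SPdamp.toModel.Ypol 0 1 * (9425 / 1182)
          * Λ.P (Sum.inl 0) (Sum.inr 1)) ^ 2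
      + ((5372811 : ℝ) / 5000000 * WSCC9.postB_SPdamp.toModel.Ypol 0 2 * (9425 / 1182)
          * Λ.P (Sum.inl 0) (Sum.inr 1) + (1 + Λ.g) / 2) ^ 2
      + ((27741033 : ℝ) / 25000000 * WSCC9.postB_SPdamp.toModel.Ypol 1 0 * (1885 / 64)
          * Λ.P (Sum.inl 1) (Sum.inr 1)) ^ 2
      + ((5340267 : ℝ) / 5000000 * WSCC9.postB_SPdamp.toModel.Ypol 1 2 * (1885 / 64)
          * Λ.P (Sum.inl 1) (Sum.inr 1) + (1 + Λ.g) / 2) ^ 2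
      + ((5372811 : ℝ) / 5000000 * WSCC9.postB_SPdamp.toModel.Ypol 2 0 * (18850 / 301)
          * Λ.P (Sum.inl 2) (Sum.inr 1) - (1 + Λ.g) / 2) ^ 2
      + ((5340267 : ℝ) / 5000000 * WSCC9.postB_SPdamp.toModel.Ypol 2 1 * (18850 / 301)
          * Λ.P (Sum.inl 2) (Sum.inr 1) - (1 + Λ.g) / 2) ^ 2
      ≤ 4 * Λ.g := by
  have h := lmi_quadForm Λ (Sum.elim ![0, 0, 0] ![0, 1])
  rw [lurieSystem_A, lurieSystem_B, lurieSystem_C] at h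
  simp [InternalNode.refT, InternalNode.pairIncidence, System.directedInput,
    InternalNode.channelWeight, Matrix.mulVec, dotProduct, Fintype.sum_sum_type, Fintype.sum_prod_type,
    Fin.sum_univ_three, Fin.sum_univ_two, Matrix.fromBlocks, Matrix.fromRows, Matrix.fromCols,
    Matrix.mul_apply, Matrix.diagonal, ClassicalSwing.toLitNode_M, tE, tM, tD, WSCC9.E, WSCC9.M,
    WSCC9.D_SP] at h
  norm_num at h
  nlinarith [h]

/-! ### Auxiliary facts: symmetry of `P`, enclosures of the directed weights, the sector ceiling -/

/-- `P` is symmetric entrywise. -/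
theorem P_symm_apply (Λ : QuadraticCertificate WSCC9.lurieSystem) (i j : Fin 3 ⊕ Fin 2) :
    Λ.P i j = Λ.P j i := by
  have h := congrFun (congrFun Λ.P_symm j) i
  rw [Matrix.transpose_apply] at h
  exact h

/-- Rational enclosure of a polar modulus `Y_ij = √(B_ij² + G_ij²)` from `lo² ≤ Y² ≤ hi²` over `ℚ`. -/
theorem Ypol_bounds {i j : Fin 3} {lo hi : ℚ} (hlo : 0 ≤ lo) (hhi : 0 ≤ hi)
    (h1 : lo ^ 2 ≤ WSCC9.postB_SPdamp.Ysq i j) (h2 : WSCC9.postB_SPdamp.Ysq i j ≤ hi ^ 2) :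
    ((lo : ℚ) : ℝ) ≤ WSCC9.postB_SPdamp.toModel.Ypol i j ∧ WSCC9.postB_SPdamp.toModel.Ypol i j ≤ ((hi : ℚ) : ℝ) := by
  have hsq := WSCC9.postB_SPdamp.Ypol_sq_cast i j
  have hY : 0 ≤ WSCC9.postB_SPdamp.toModel.Ypol i j := by
    unfold ClassicalSwing.Ypol; exact Real.sqrt_nonneg _
  have h1' : ((lo : ℚ) : ℝ) ^ 2 ≤ WSCC9.postB_SPdamp.toModel.Ypol i j ^ 2 := by
    rw [hsq]; exact_mod_cast h1
  have h2' : WSCC9.postB_SPdamp.toModel.Ypol i j ^ 2 ≤ ((hi : ℚ) : ℝ) ^ 2 := by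
    rw [hsq]; exact_mod_cast h2
  have hlo' : (0 : ℝ) ≤ ((lo : ℚ) : ℝ) := by exact_mod_cast hlo
  have hhi' : (0 : ℝ) ≤ ((hi : ℚ) : ℝ) := by exact_mod_cast hhi
  constructor
  · nlinarith
  · nlinarith

/-- `0.7393042 ≤ Y₀₁ = Y₁₀ ≤ 0.7393043`. -/
theorem Y01_bounds :
    (((3696521 / 5000000 : ℚ) : ℚ) : ℝ) ≤ WSCC9.postB_SPdamp.toModel.Ypol 0 1 ∧
      WSCC9.postB_SPdamp.toModel.Ypol 0 1 ≤ (((7393043 / 10000000 : ℚ) : ℚ) : ℝ) :=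
  Ypol_bounds (by norm_num) (by norm_num) (by decide +kernel) (by decide +kernel)

/-- `0.7393042 ≤ Y₁₀ ≤ 0.7393043`. -/
theorem Y10_bounds :
    (((3696521 / 5000000 : ℚ) : ℚ) : ℝ) ≤ WSCC9.postB_SPdamp.toModel.Ypol 1 0 ∧
      WSCC9.postB_SPdamp.toModel.Ypol 1 0 ≤ (((7393043 / 10000000 : ℚ) : ℚ) : ℝ) :=
  Ypol_bounds (by norm_num) (by norm_num) (by decide +kernel) (by decide +kernel)

/-- `1.0961464 ≤ Y₀₂ ≤ 1.0961465`. -/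
theorem Y02_bounds :
    (((1370183 / 1250000 : ℚ) : ℚ) : ℝ) ≤ WSCC9.postB_SPdamp.toModel.Ypol 0 2 ∧
      WSCC9.postB_SPdamp.toModel.Ypol 0 2 ≤ (((2192293 / 2000000 : ℚ) : ℚ) : ℝ) :=
  Ypol_bounds (by norm_num) (by norm_num) (by decide +kernel) (by decide +kernel)

/-- `1.0961464 ≤ Y₂₀ ≤ 1.0961465`. -/
theorem Y20_bounds :
    (((1370183 / 1250000 : ℚ) : ℚ) : ℝ) ≤ WSCC9.postB_SPdamp.toModel.Ypol 2 0 ∧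
      WSCC9.postB_SPdamp.toModel.Ypol 2 0 ≤ (((2192293 / 2000000 : ℚ) : ℚ) : ℝ) :=
  Ypol_bounds (by norm_num) (by norm_num) (by decide +kernel) (by decide +kernel)

/-- `1.2452809 ≤ Y₁₂ ≤ 1.245281`. -/
theorem Y12_bounds :
    (((12452809 / 10000000 : ℚ) : ℚ) : ℝ) ≤ WSCC9.postB_SPdamp.toModel.Ypol 1 2 ∧
      WSCC9.postB_SPdamp.toModel.Ypol 1 2 ≤ (((1245281 / 1000000 : ℚ) : ℚ) : ℝ) :=
  Ypol_bounds (by norm_num) (by norm_num) (by decide +kernel) (by decide +kernel)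

/-- `1.2452809 ≤ Y₂₁ ≤ 1.245281`. -/
theorem Y21_bounds :
    (((12452809 / 10000000 : ℚ) : ℚ) : ℝ) ≤ WSCC9.postB_SPdamp.toModel.Ypol 2 1 ∧
      WSCC9.postB_SPdamp.toModel.Ypol 2 1 ≤ (((1245281 / 1000000 : ℚ) : ℚ) : ℝ) :=
  Ypol_bounds (by norm_num) (by norm_num) (by decide +kernel) (by decide +kernel)

end Instance

end Summit.Ventures.GridStability.Lyapunov.LurieObstruction

end
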